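import Summits.AnomalousDissipation.AnomalousDissipation.Theses.VirtualDissipation
import Summits.AnomalousDissipation.AnomalousDissipation.Theorems.LightSteadyStatesGP.Negative.TrivialWitnesses
import Literature.Analysis.FunctionSpaces.TorusFluidGlueProofs

/-!
# Negative lemmas for crux `LightSteadyStatesGP` (stmt-AnomalousDissipation-15151, route VirtualDissipation) —
# the crux CAPS the Lamb-rigidity constant of `f_GP` at `√3`; a disproof is a rigidity constant above `√3`
# (refuter cdisprove, cycle 1, 2026-08-17)

The route closes `AnomalousDissipation` from `LambRigidGP` (crux 2: `f_GP` is Lamb-rigid at some level `E ≥ 2`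
with SOME constant `c > 0`) and `LightSteadyStatesGP` (crux 3, this file's item: light mean-zero classical steady
states of `f_GP` along `ν_j → 0`).  The two cruxes are coupled through ONE number, the rigidity constant:

* `residual_le` — RESIDUAL TRANSFER at a classical steady state of `NS_ν(f_GP)`, `ν > 0`: `R = ν‖∇u‖₂` is an
  admissible dual-enstrophy bound of the Euler residual, `|∫⟪(u·∇)u − f_GP, w⟫| ≤ (ν‖∇u‖₂)‖∇w‖₂` for all
  smooth divergence-free mean-zero `w` (the computation inside the route's `closes`, as a lemma);
* `dissipation_sq_le_of_light` — a LIGHT steady state (`∫|u|² ≤ 2`) has `(ν‖∇u‖₂²)² ≤ 3`;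
* **`rigidityConstant_le_sqrt_three_of_lightSteadyStatesGP`** — if `LightSteadyStatesGP` holds then, at EVERY
  level `E ≥ 2` and for all `δ₀ > 0`, every constant `c` for which the Lamb-rigidity inequality of `f_GP` holds
  (the body of `LambRigidGP`, verbatim) satisfies `c ≤ √3`: a witness slice with `ν_j < δ₀²/2` has
  `R_j² = ν_j ε_j < δ₀²` and `R_j‖∇u_j‖₂ = ε_j ≤ √3`;
* contrapositive (stated in the crux work file `Cruxes/LightSteadyStatesGP/Disproof.lean` as
  `not_crux_of_strongLambRigidGP`, kept out of this pure-support file): Lamb rigidity of `f_GP` in the 2-ball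
  with a constant `c > √3` (the natural STRENGTHENING of the sibling crux) REFUTES this crux.  So the pair of
  cruxes is consistent only in the band `min(c, δ₀²) ≤ ε_j ≤ √3`, and a disproof of `LightSteadyStatesGP` in the
  route's own currency is exactly a super-`√3` viscosity-free rigidity theorem for `f_GP` — a super-Onsager
  statement, against which the light numerical branch (`ε ≈ 0.36`, item evidence NumericsJ018975.md) is trend
  evidence;
* Read on the sibling crux: under `LightSteadyStatesGP`, every witness `(E, c, δ₀)` of `LambRigidGP` has
  `c ≤ √3` (`obtain ⟨E, c, δ₀, hE, hc, hδ₀, hrig⟩ := hLamb` and apply the cap; the inline force of the route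
  file is `gpForce` by `rfl`).

Helpers `energy_identity`, `work_sq_le` are private copies of `Negative/LevelFloor.lean` (proposed separately).
-/

set_option linter.dupNamespace false

noncomputable section

open MeasureTheory Set Filter Topology
open scoped InnerProductSpace RealInnerProductSpace

namespace Summit.AnomalousDissipation.AnomalousDissipation.Theorems.LightSteadyStatesGP.Negative.RigidityCap

open Literature.Analysis.FunctionSpaces Literature.Analysis.FluidPDE
open Summit.AnomalousDissipation.AnomalousDissipation.Theorems.EnsembleRigidity
open Summit.AnomalousDissipation.AnomalousDissipation.Theorems.EnsembleRigidity.GPStatisticalRigidity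
open Summit.AnomalousDissipation.AnomalousDissipation.Theorems.EnsembleRigidity.GPMeanBoundedFamily

/-! ## §1 Private a-priori bookkeeping -/

/-- `ν‖∇u‖² = ∫⟪f_GP,u⟫` (private copy of `Negative.LevelFloor.energy_identity`). [folklore] -/
private theorem energy_identity {ν : ℝ} {u : UnitAddTorus (Fin 3) → EuclideanSpace ℝ (Fin 3)}
    {p : UnitAddTorus (Fin 3) → ℝ}
    (h : Torus.IsClassicalNSSolutionOn Set.univ ν (fun _ => gpForce) (fun _ => u) (fun _ => p)) :
    ν * Torus.gradNormSq u = ∫ x, ⟪gpForce x, u x⟫_ℝ := by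
  have hd := Torus.IsClassicalNSSolutionOn.energy_balance_holds h convex_univ (Set.mem_univ (0 : ℝ))
  rw [hasDerivWithinAt_univ] at hd
  have h0 : HasDerivAt (fun _ : ℝ => Torus.kineticEnergy u) (0 : ℝ) (0 : ℝ) := hasDerivAt_const _ _
  have := h0.unique hd
  linarith

/-- `(∫⟪f_GP,u⟫)² ≤ (3/2)∫|u|²` (private copy of `Negative.LevelFloor.work_sq_le`). [folklore] -/
private theorem work_sq_le {u : UnitAddTorus (Fin 3) → EuclideanSpace ℝ (Fin 3)} (hu : Torus.IsSmooth u) :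
    (∫ x, ⟪gpForce x, u x⟫_ℝ) ^ 2 ≤ 3 / 2 * ∫ x, ‖u x‖ ^ 2 := by
  have hfs : Torus.IsSmooth gpForce := gpForce_isSmooth
  have key : ∀ t : ℝ, 2 * t * ∫ x, ⟪gpForce x, u x⟫_ℝ ≤ t ^ 2 * (3 / 2) + ∫ x, ‖u x‖ ^ 2 := by
    intro t
    have hpt : ∀ x, 2 * t * ⟪gpForce x, u x⟫_ℝ ≤ t ^ 2 * ‖gpForce x‖ ^ 2 + ‖u x‖ ^ 2 := by
      intro x
      have h0 : 0 ≤ ‖t • gpForce x - u x‖ ^ 2 := sq_nonneg _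
      rw [norm_sub_sq_real, real_inner_smul_left, norm_smul, mul_pow, Real.norm_eq_abs, sq_abs] at h0
      linarith
    have i1 : Integrable (fun x => 2 * t * ⟪gpForce x, u x⟫_ℝ) volume := (hfs.inner hu).integrable.const_mul _
    have i2 : Integrable (fun x => t ^ 2 * ‖gpForce x‖ ^ 2 + ‖u x‖ ^ 2) volume :=
      (hfs.norm_sq.integrable.const_mul _).add hu.norm_sq.integrable
    have h := integral_mono i1 i2 hpt
    rw [integral_const_mul, integral_add (hfs.norm_sq.integrable.const_mul _) hu.norm_sq.integrable,
      integral_const_mul, StubHeadCoefficients.integral_norm_sq_gpForce] at h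
    exact h
  set W := ∫ x, ⟪gpForce x, u x⟫_ℝ with hW
  have h := key (2 * W / 3)
  nlinarith [h]

/-- **A light steady state dissipates at most `√3`**: `(ν‖∇u‖₂²)² ≤ 3` when `∫|u|² ≤ 2`. [folklore] -/
theorem dissipation_sq_le_of_light {ν : ℝ} {u : UnitAddTorus (Fin 3) → EuclideanSpace ℝ (Fin 3)}
    {p : UnitAddTorus (Fin 3) → ℝ}
    (h : Torus.IsClassicalNSSolutionOn Set.univ ν (fun _ => gpForce) (fun _ => u) (fun _ => p))
    (hE : ∫ x, ‖u x‖ ^ 2 ≤ 2) :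
    (ν * Torus.gradNormSq u) ^ 2 ≤ 3 := by
  rw [energy_identity h]
  have h1 := work_sq_le (h.smooth_velocity.isSmooth_slice (Set.mem_univ (0 : ℝ)))
  nlinarith [h1, hE]

/-! ## §2 Residual transfer -/

/-- **Residual transfer**: at a classical steady state of `NS_ν(f_GP)`, `ν > 0`, the Euler residual functional
IS the viscous pairing `w ↦ ν∫⟪w, Δu⟫`, hence `|∫⟪(u·∇)u − f_GP, w⟫| ≤ (ν‖∇u‖₂)‖∇w‖₂` for every smooth
divergence-free mean-zero `w` (Green + Cauchy–Schwarz, `PhantomFloor.abs_integral_inner_laplacian_le`). [folklore] -/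
theorem residual_le {ν : ℝ} (hν : 0 < ν) {u : UnitAddTorus (Fin 3) → EuclideanSpace ℝ (Fin 3)}
    {p : UnitAddTorus (Fin 3) → ℝ}
    (h : Torus.IsClassicalNSSolutionOn Set.univ ν (fun _ => gpForce) (fun _ => u) (fun _ => p)) :
    ∀ w : UnitAddTorus (Fin 3) → EuclideanSpace ℝ (Fin 3), Torus.IsSmooth w → Torus.IsDivFree w →
      Torus.HasZeroMean w →
      |∫ x, ⟪Torus.convect u u x - gpForce x, w x⟫_ℝ| ≤
        (ν * Real.sqrt (Torus.gradNormSq u)) * Real.sqrt (Torus.gradNormSq w) := by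
  -- pattern from the route's `closes` (Theses/VirtualDissipation.lean, `hres`)
  intro w hw hwd hwz
  have hu : Torus.IsSmooth u := h.smooth_velocity.isSmooth_slice (Set.mem_univ (0 : ℝ))
  have hp : Torus.IsSmooth p := h.smooth_pressure.isSmooth_slice (Set.mem_univ (0 : ℝ))
  have hfs : Torus.IsSmooth gpForce := gpForce_isSmooth
  have hpt : ∀ x, ν • Torus.laplacian u x - Torus.convect u u x + gpForce x = Torus.gradient p x := by
    intro x
    have hm := h.momentum 0 (Set.mem_univ _) x
    have h0 : Torus.timeDerivWithin Set.univ (fun _ : ℝ => u) 0 x = 0 := by simp [Torus.timeDerivWithin]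
    rw [h0, zero_add] at hm
    have hm' : Torus.convect u u x = ν • Torus.laplacian u x - Torus.gradient p x + gpForce x := hm
    rw [hm']
    abel
  have h0 : ∫ x, ⟪ν • Torus.laplacian u x - Torus.convect u u x + gpForce x, w x⟫_ℝ = 0 := by
    simp_rw [hpt]
    exact Torus.integral_inner_gradient_eq_zero_of_isDivFree hw hp hwd
  have iL : Integrable (fun x => ⟪ν • Torus.laplacian u x, w x⟫_ℝ) volume :=
    ((hu.laplacian.smul ν).inner hw).integrable
  have iC : Integrable (fun x => ⟪Torus.convect u u x, w x⟫_ℝ) volume := ((hu.convect hu).inner hw).integrable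
  have iF : Integrable (fun x => ⟪gpForce x, w x⟫_ℝ) volume := (hfs.inner hw).integrable
  have iLC : Integrable (fun x => ⟪ν • Torus.laplacian u x, w x⟫_ℝ - ⟪Torus.convect u u x, w x⟫_ℝ) volume :=
    iL.sub iC
  simp_rw [inner_add_left, inner_sub_left] at h0
  rw [integral_add iLC iF, integral_sub iL iC] at h0
  have hlap : ∫ x, ⟪ν • Torus.laplacian u x, w x⟫_ℝ = ν * ∫ x, ⟪w x, Torus.laplacian u x⟫_ℝ := by
    simp_rw [real_inner_smul_left]
    rw [integral_const_mul]
    exact congrArg _ (integral_congr_ae (ae_of_all _ fun x => real_inner_comm _ _))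
  have heq : ∫ x, ⟪Torus.convect u u x - gpForce x, w x⟫_ℝ = ν * ∫ x, ⟪w x, Torus.laplacian u x⟫_ℝ := by
    simp_rw [inner_sub_left]
    rw [integral_sub iC iF]
    linarith
  rw [heq, abs_mul, abs_of_nonneg hν.le, mul_assoc]
  refine mul_le_mul_of_nonneg_left ?_ hν.le
  rw [mul_comm]
  exact Summit.AnomalousDissipation.AnomalousDissipation.Theorems.PhantomFloor.abs_integral_inner_laplacian_le hw hu

/-! ## §3 The cap on the rigidity constant -/

/-- **The crux caps the Lamb-rigidity constant of `f_GP` at `√3`.**  If `LightSteadyStatesGP` holds, then for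
every level `E ≥ 2`, every `δ₀ > 0` and every `c` for which the Lamb-rigidity inequality of `f_GP` holds at
`(E, c, δ₀)` (the body of the sibling crux `LambRigidGP`, verbatim), `c ≤ √3`.  Contrapositive: a rigidity
constant `> √3` at level `2` refutes the crux. [folklore] -/
theorem rigidityConstant_le_sqrt_three_of_lightSteadyStatesGP
    (hC : Summit.AnomalousDissipation.AnomalousDissipation.Theses.VirtualDissipation.LightSteadyStatesGP)
    {E c δ₀ : ℝ} (hE : 2 ≤ E) (hδ₀ : 0 < δ₀)
    (hrig : ∀ u : UnitAddTorus (Fin 3) → EuclideanSpace ℝ (Fin 3), Torus.IsSmooth u → Torus.IsDivFree u →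
        Torus.HasZeroMean u → ∫ x, ‖u x‖ ^ 2 ≤ E → ∀ R : ℝ, 0 ≤ R →
          (∀ w : UnitAddTorus (Fin 3) → EuclideanSpace ℝ (Fin 3), Torus.IsSmooth w → Torus.IsDivFree w →
            Torus.HasZeroMean w →
            |∫ x, ⟪Torus.convect u u x - gpForce x, w x⟫_ℝ| ≤ R * Real.sqrt (Torus.gradNormSq w)) →
          R ≤ δ₀ → c ≤ R * Real.sqrt (Torus.gradNormSq u)) :
    c ≤ Real.sqrt 3 := by
  obtain ⟨ν, u, p, hν, hν0, hsol, hmean, hlight⟩ := hC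
  obtain ⟨j, hj⟩ := ((tendsto_order.1 hν0).2 (δ₀ ^ 2 / 2) (by positivity)).exists
  have hνj : 0 < ν j := (hν j).1
  have hsolj : Torus.IsClassicalNSSolutionOn Set.univ (ν j) (fun _ => gpForce) (fun _ => u j) (fun _ => p j) :=
    hsol j
  have hus : Torus.IsSmooth (u j) := hsolj.smooth_velocity.isSmooth_slice (Set.mem_univ (0 : ℝ))
  have hud : Torus.IsDivFree (u j) := hsolj.divFree 0 (Set.mem_univ _)
  set G := Torus.gradNormSq (u j) with hGdef
  have hG : 0 ≤ G := Torus.gradNormSq_nonneg _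
  set R := ν j * Real.sqrt G with hRdef
  have hR0 : 0 ≤ R := mul_nonneg hνj.le (Real.sqrt_nonneg _)
  have hRG : R * Real.sqrt G = ν j * G := by rw [hRdef, mul_assoc, Real.mul_self_sqrt hG]
  have hεsq : (ν j * G) ^ 2 ≤ 3 := dissipation_sq_le_of_light hsolj (hlight j)
  have hε0 : 0 ≤ ν j * G := mul_nonneg hνj.le hG
  have hε2 : ν j * G < 2 := by nlinarith
  have hR2 : R ^ 2 = ν j * (ν j * G) := by rw [hRdef, mul_pow, Real.sq_sqrt hG]; ring
  have hRδ : R ≤ δ₀ := by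
    have h1 : R ^ 2 < δ₀ ^ 2 := by
      rw [hR2]
      have : ν j * (ν j * G) ≤ ν j * 2 := mul_le_mul_of_nonneg_left hε2.le hνj.le
      nlinarith
    exact le_of_lt (lt_of_pow_lt_pow_left₀ 2 hδ₀.le h1)
  have key := hrig (u j) hus hud (hmean j) ((hlight j).trans hE) R hR0 (residual_le hνj hsolj) hRδ
  rw [hRG] at key
  have hεle : ν j * G ≤ Real.sqrt 3 := by
    rw [← Real.sqrt_sq hε0]
    exact Real.sqrt_le_sqrt hεsq
  exact key.trans hεle

end Summit.AnomalousDissipation.AnomalousDissipation.Theorems.LightSteadyStatesGP.Negative.RigidityCap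

end
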